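import Mathlib.NumberTheory.NumberField.Basic
import Mathlib.RingTheory.AdjoinRoot
import Mathlib.RingTheory.Polynomial.UniqueFactorization
import Mathlib.FieldTheory.IntermediateField.Adjoin.Algebra
import Mathlib.Algebra.Polynomial.Degree.Domain
import HarnessLib

/-!
# Number fields generated by a root of a given polynomial (existence, with the degree bound)

For a number field `F` and a non-constant polynomial `f ∈ F[X]` there is a number field `M = F(r)`
GENERATED over `F` by a root `r` of `f`, with `[M : F] ≤ deg f` (take an irreducible factor `g` of
`f` and `M := F[X]/(g)`).  In particular, for `a ∈ F` and `e ≥ 1` there is a number field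
`M = F(r)` with `r^e = a`, `[M : F] ≤ e` and `[M : ℚ] ≤ e·[F : ℚ]` — the field of definition of a
point of a Kummer (superelliptic) cover `r^e = a(x)` lying over a given point `x`, in the exact shape
(`Algebra F M`, `r : M`, `r ^ e = algebraMap F M a`, `IntermediateField.adjoin F {r} = ⊤`) in which
relative different / discriminant bounds for simple radical extensions are consumed.

* `exists_numberField_adjoin_root_eq_top` — the general statement for `f` with `natDegree f ≠ 0`;
* `exists_numberField_kummer_generator` — the radical case `f = X^e − a`, with both degree bounds.

Kronecker's construction `F[X]/(g)` (Lang, *Algebra*, Ch. V §2 Prop. 2.3: a polynomial of degree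
`n ≥ 1` acquires a root in an extension of degree `≤ n`) [cite: Lang2002, Ch. V §2 Prop. 2.3].  abc-iut cell: glue for
the GenEllTwo package (stmt-ABC-19679: the points of the cyclic cover `r^e = x(1−x)` of
`ℙ¹ ∖ {0,1,∞}` over a given `x`); classical, nothing disputed.  Theorems only, no definitions.
-/

noncomputable section

open Polynomial

namespace Literature.NumberTheory.NumberFields

universe u

/-- **A number field generated by a root of a non-constant polynomial.**  For a number field `F` and
`f ∈ F[X]` with `deg f ≥ 1` there are a number field `M ⊇ F` and `r ∈ M` with `f(r) = 0`,
`M = F(r)` and `[M : F] ≤ deg f` (namely `M = F[X]/(g)` for an irreducible factor `g ∣ f`,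
`[M : F] = deg g ≤ deg f`) — Kronecker's construction, finite over `F` hence a number field.
[cite: Lang2002, Ch. V §2 Prop. 2.3] -/
theorem exists_numberField_adjoin_root_eq_top (F : Type u) [Field F] [NumberField F] (f : F[X])
    (hf : f.natDegree ≠ 0) :
    ∃ (M : Type u) (_ : Field M) (_ : NumberField M) (_ : Algebra F M) (r : M),
      aeval r f = 0 ∧ IntermediateField.adjoin F {r} = ⊤ ∧ Module.finrank F M ≤ f.natDegree := by
  have hf0 : f ≠ 0 := by
    rintro rfl
    exact hf natDegree_zero
  obtain ⟨g, hg, hgf⟩ := exists_irreducible_of_natDegree_pos (Nat.pos_of_ne_zero hf)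
  haveI : Fact (Irreducible g) := ⟨hg⟩
  have hg0 : g ≠ 0 := hg.ne_zero
  haveI : Module.Finite F (AdjoinRoot g) := (AdjoinRoot.powerBasis hg0).finite
  haveI : NumberField (AdjoinRoot g) := NumberField.of_module_finite F (AdjoinRoot g)
  refine ⟨AdjoinRoot g, inferInstance, inferInstance, inferInstance, AdjoinRoot.root g, ?_, ?_, ?_⟩
  · rw [AdjoinRoot.aeval_eq, AdjoinRoot.mk_eq_zero]
    exact hgf
  · exact IntermediateField.adjoin_eq_top_of_algebra F _ (AdjoinRoot.adjoinRoot_eq_top)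
  · rw [(AdjoinRoot.powerBasis hg0).finrank, AdjoinRoot.powerBasis_dim]
    exact natDegree_le_of_dvd hgf hf0

/-- **Kummer generators exist.**  For a number field `F`, `a ∈ F` and `e ≥ 1` there are a number field
`M ⊇ F` and `r ∈ M` with `r^e = a`, `M = F(r)`, `[M : F] ≤ e` and `[M : ℚ] ≤ e·[F : ℚ]` (a root of
`X^e − a` generating `M`; the tower law).  This is the field of definition of a point of the Kummer
cover `r^e = a` over the given point (Kronecker's construction applied to `X^e − a`).
[cite: Lang2002, Ch. V §2 Prop. 2.3] -/
theorem exists_numberField_kummer_generator (F : Type u) [Field F] [NumberField F] (a : F) {e : ℕ}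
    (he : 0 < e) :
    ∃ (M : Type u) (_ : Field M) (_ : NumberField M) (_ : Algebra F M) (r : M),
      r ^ e = algebraMap F M a ∧ IntermediateField.adjoin F {r} = ⊤ ∧ Module.finrank F M ≤ e ∧
        Module.finrank ℚ M ≤ e * Module.finrank ℚ F := by
  have hdeg : (X ^ e - C a : F[X]).natDegree = e := natDegree_X_pow_sub_C
  obtain ⟨M, _, _, _, r, hr, htop, hfin⟩ :=
    exists_numberField_adjoin_root_eq_top F (X ^ e - C a) (by rw [hdeg]; exact he.ne')
  refine ⟨M, inferInstance, inferInstance, inferInstance, r, ?_, htop, by rwa [hdeg] at hfin, ?_⟩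
  · have h : aeval r (X ^ e - C a : F[X]) = r ^ e - algebraMap F M a := by
      simp [map_sub, aeval_X_pow, aeval_C]
    rw [h] at hr
    exact sub_eq_zero.mp hr
  · rw [hdeg] at hfin
    rw [← Module.finrank_mul_finrank ℚ F M, mul_comm]
    exact Nat.mul_le_mul_right _ hfin

end Literature.NumberTheory.NumberFields

end
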